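import Summits.Ventures.PercRepro.MSTightBlockInjection
import Summits.Ventures.PercRepro.MSTightNoMemberContains

/-!
# The block lemma (BNT) at the instance level (Addendum 39, Step 1)

Dossier proofs/MINE1-theoremS.md, Addendum 39 (Step 1, Lemma (BNT)), and
proofs/MINE1-RSTARM-PROOF.md §5 (Lemma C). Let `u` be the set of the instance, `U` its up-set,
`T ⊆ U` the family, `Λ = {g ⊆ u : u \ g ∈ U}` the link of `ū` (the `u`-complements of the members
of `U` inside `u`), `P^out` the traces `y ∩ u` of the members `y ⊄ u`, `Q = ↓P^out`, and
`K⁺ = Q ∩ U` (the members of `T` inside `u` below an outside trace, by `T = U ∩ ↓T`). Let `ρ`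
(in the instance `ρ^* = ⋂_m (u ∩ R*(K_m))`) satisfy

* `hZ`: every member of `U` inside `u` contains a member of `U` inside `ρ` (every minimal member of
  `U ∩ 2^u` lies inside `ρ`: (F7) at each outside vertex, `MSTightAdjoin.lean`);
* `hout`: every member `y ⊄ u` has an outside vertex `m ∈ y` which is a non-tightening direction
  with nonempty partner family and `ρ ⊆ u ∩ R*(partner m T)`.

Then **`|Λ ∩ Q| ≤ |K⁺|`** (`card_link_inter_le_card`): the map `g ↦ g ∆ ρ` of
`MSTightBlockInjection.lean` applies — `ρ \ g ∈ U` for `g ∈ Λ` by `sdiff_mem_of_forall_exists_subset`,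
and `g ∪ ρ ∈ Q` for `g ∈ Λ ∩ Q` because `g ∪ ρ` lies below the trace of the member `y ∪ R*(K_m)`
(`union_Rstar_mem_of_mem`, `MSTightNoMemberContains.lean`). This is the counting half of the merge
(Addendum 39, Step 2); the merged instance itself is the subtype transport.
-/

namespace PercRepro.MSTight

open Finset

variable {α : Type*} [DecidableEq α] [Fintype α]

/-- The link of `ū`: the subsets `g` of `u` whose `u`-complement is a member of `U`. -/
def link (U : Finset (Finset α)) (u : Finset α) : Finset (Finset α) :=
  univ.filter fun g => g ⊆ u ∧ u \ g ∈ U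

/-- The outside traces: `y ∩ u` for the members `y ⊄ u`. -/
def outTraces (T : Finset (Finset α)) (u : Finset α) : Finset (Finset α) :=
  (T.filter fun y => ¬ y ⊆ u).image fun y => y ∩ u

/-- The faces below an outside trace. -/
def outFaces (T : Finset (Finset α)) (u : Finset α) : Finset (Finset α) :=
  univ.filter fun x => ∃ t ∈ outTraces T u, x ⊆ t

/-- Membership in the link. -/
theorem mem_link {U : Finset (Finset α)} {u g : Finset α} :
    g ∈ link U u ↔ g ⊆ u ∧ u \ g ∈ U := by
  simp [link]

omit [Fintype α] in
/-- Membership in the outside traces. -/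
theorem mem_outTraces {T : Finset (Finset α)} {u t : Finset α} :
    t ∈ outTraces T u ↔ ∃ y ∈ T, ¬ y ⊆ u ∧ y ∩ u = t := by
  simp only [outTraces, mem_image, mem_filter]
  constructor
  · rintro ⟨y, ⟨hy, hyu⟩, rfl⟩
    exact ⟨y, hy, hyu, rfl⟩
  · rintro ⟨y, hy, hyu, rfl⟩
    exact ⟨y, ⟨hy, hyu⟩, rfl⟩

/-- Membership in the outside faces. -/
theorem mem_outFaces {T : Finset (Finset α)} {u x : Finset α} :
    x ∈ outFaces T u ↔ ∃ t ∈ outTraces T u, x ⊆ t := by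
  simp [outFaces]

/-- The outside faces form a down-set. -/
theorem outFaces_downSet (T : Finset (Finset α)) (u : Finset α) :
    ∀ x ∈ outFaces T u, ∀ y, y ⊆ x → y ∈ outFaces T u := by
  intro x hx y hyx
  obtain ⟨t, ht, hxt⟩ := mem_outFaces.1 hx
  exact mem_outFaces.2 ⟨t, ht, hyx.trans hxt⟩

/-- **The block lemma (BNT).** -/
theorem card_link_inter_le_card {U T : Finset (Finset α)} {u ρ : Finset α}
    (hU : ∀ x ∈ U, ∀ x', x ⊆ x' → x' ∈ U)
    (hZ : ∀ x ∈ U, x ⊆ u → ∃ z ∈ U, z ⊆ x ∧ z ⊆ ρ)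
    (hout : ∀ y ∈ T, ¬ y ⊆ u → ∃ m ∈ y,
      (diffsX m T ∩ diffsY m T).card = (partner m T).card ∧ (partner m T).Nonempty ∧
      ρ ⊆ u ∩ Rstar (partner m T)) :
    (link U u ∩ outFaces T u).card ≤ (outFaces T u ∩ U).card := by
  refine card_inter_le_card_inter_of_symmDiff (ρ := ρ) (outFaces_downSet T u) hU ?_ ?_
  · intro g hg
    exact sdiff_mem_of_forall_exists_subset hU hZ (mem_link.1 hg).2
  · intro g hg hgQ
    obtain ⟨hgu, _⟩ := mem_link.1 hg
    obtain ⟨t, ht, hgt⟩ := mem_outFaces.1 hgQ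
    obtain ⟨y, hy, hyu, rfl⟩ := mem_outTraces.1 ht
    obtain ⟨m, hmy, hε, hK, hρ⟩ := hout y hy hyu
    have hy' : y ∪ Rstar (partner m T) ∈ T := union_Rstar_mem_of_mem hε hK hy hmy
    have hy'u : ¬ y ∪ Rstar (partner m T) ⊆ u := fun h => hyu (subset_union_left.trans h)
    refine mem_outFaces.2 ⟨(y ∪ Rstar (partner m T)) ∩ u, mem_outTraces.2 ⟨_, hy', hy'u, rfl⟩, ?_⟩
    intro a ha
    rw [mem_inter, mem_union]
    rcases mem_union.1 ha with h | h
    · exact ⟨Or.inl (mem_inter.1 (hgt h)).1, hgu h⟩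
    · have := hρ h
      rw [mem_inter] at this
      exact ⟨Or.inr this.2, this.1⟩

/-- With `T = U ∩ ↓T`, the right-hand side is `K⁺`, the members of `T` inside `u` below an outside
trace: `outFaces T u ∩ U = (T.filter (· ⊆ u)) ∩ outFaces T u`. -/
theorem outFaces_inter_eq {U T : Finset (Finset α)} {u : Finset α} (hTU : T ⊆ U)
    (hF2 : ∀ x ∈ U, (∃ t ∈ T, x ⊆ t) → x ∈ T) :
    outFaces T u ∩ U = (T.filter fun y => y ⊆ u) ∩ outFaces T u := by
  ext x
  simp only [mem_inter, mem_filter]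
  constructor
  · rintro ⟨hxQ, hxU⟩
    obtain ⟨t, ht, hxt⟩ := mem_outFaces.1 hxQ
    obtain ⟨y, hy, _, rfl⟩ := mem_outTraces.1 ht
    refine ⟨⟨hF2 x hxU ⟨y, hy, hxt.trans inter_subset_left⟩, hxt.trans inter_subset_right⟩, hxQ⟩
  · rintro ⟨⟨hxT, _⟩, hxQ⟩
    exact ⟨hxQ, hTU hxT⟩

end PercRepro.MSTight
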